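import Summits.RiemannHypothesis.RiemannHypothesis.Theorems.WeilFormatCArchSectorEntries
import HarnessLib

/-!
# Format C: the archimedean sector kernels = Hilbert main part `±(−1)^{n+m}/(4(n+m))` + small remainder;
  diagonal lower bounds

Route context: Fourier–Galerkin / Schur-complement certificates of Weil positivity on a window ("format C";
cell memo `run/shared/lean/pub/rh-explicit/rh-explicit-weil-10/FORMATC-DESIGN.md` §4.3 DIG/EXP/DIAG, §9.1; supporting
stmt-RiemannHypothesis-0098; seat rh-explicit-weil-10).  Sequel of `WeilFormatCArchSectorEntries.lean` (closed forms
`evenArch_offDiag_eq` / `oddArch_offDiag_eq` / `evenArch_diag_eq` / `oddArch_diag_eq` and the entry bounds).  With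
`Y_n = π/2 + r_n`, `|r_n| ≤ 2a/(πn)` (D1) and `0 ≤ T_n ≤ Ea/(πn)` (`E = weilArchDensity (2a) = Σ_k e^{−2a l_k}`):

* `abs_evenArch_offDiag_sub_hilbert_le` — `|A⁺(n,m) − (−1)^{n+m}/(4(n+m))| ≤ (a(1+E)/π²)/(min(n,m)·|n−m|)` (`n ≠ m ≥ 1`);
* `abs_oddArch_offDiag_add_hilbert_le` — `|A⁻(n,m) + (−1)^{n+m}/(4(n+m))| ≤ (a(1+E)/π²)/(min(n,m)·|n−m|)`;
* `evenArch_diag_ge` — `A⁺(n,n) ≥ ½(Re ψ(¼+iω_n/2) − log π) − a(1+E)/(π²n²)` (`n ≥ 1`);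
* `oddArch_diag_ge` — `A⁻(n,n) ≥ ½(Re ψ(¼+iω_n/2) − log π) − 1/(4n) − a(1+E)/(π²n²)`,

where `A^±(n,m) = (archCoeff a n m ± archCoeff a n (−m))/2` are weil-2's SectorSplit kernels of `Yoshida1992.archCoeff a`
off mode 0 (M-units).  The remainder shape `c/(min·|n−m|)` is the hypothesis of `WeilFormatC.sum_sum_sq_le_of_offDiag_bound`
(`WeilFormatCOffDiagHSBound.lean`, Hilbert–Schmidt `≤ 8c²/M₁` on modes `> M₁`); the main parts feed
`WeilFormatC.hilbertPart_nonneg` (even) / `abs_hilbertPart_le_log` (odd).  Elementary; standard axioms; no definitions.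
-/

set_option autoImplicit false
-- `Summit.RiemannHypothesis.RiemannHypothesis.…` is the layout-mandated namespace (summit = problem name).
set_option linter.dupNamespace false

noncomputable section

open Complex Finset
open scoped Real BigOperators

namespace Summit.RiemannHypothesis.RiemannHypothesis.Theorems.WeilFormatC

open Literature.NumberTheory.LFunctions Literature.NumberTheory.LFunctions.Yoshida1992
open Literature.Analysis.SpecialFunctions

variable {a : ℝ}

/-! ## Elementary inequalities on the index weights and on products -/

/-- `2·min(n,m)·|n−m| ≤ |n² − m²|` for naturals `n, m` (as reals): `n + m ≥ 2 min(n,m)`. -/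
theorem two_mul_min_mul_abs_sub_le (n m : ℕ) :
    2 * ((min n m : ℕ) : ℝ) * |(n : ℝ) - m| ≤ |(n : ℝ) ^ 2 - m ^ 2| := by
  rw [sq_sub_sq, abs_mul, abs_of_nonneg (by positivity : (0 : ℝ) ≤ n + m)]
  have hmin : 2 * ((min n m : ℕ) : ℝ) ≤ (n : ℝ) + m := by
    rcases le_total n m with h | h
    · rw [min_eq_left h]; have : (n : ℝ) ≤ m := by exact_mod_cast h
      linarith
    · rw [min_eq_right h]; have : (m : ℝ) ≤ n := by exact_mod_cast h
      linarith
  exact mul_le_mul_of_nonneg_right hmin (abs_nonneg _)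

/-- `(n² + m²)·min(n,m)·|n−m| ≤ n·m·|n² − m²|` for naturals `n, m` (as reals): with `n ≤ m`,
`n² + m² ≤ m(n + m)`. -/
theorem sq_add_sq_mul_min_mul_abs_sub_le (n m : ℕ) :
    ((n : ℝ) ^ 2 + m ^ 2) * ((min n m : ℕ) : ℝ) * |(n : ℝ) - m| ≤ (n : ℝ) * m * |(n : ℝ) ^ 2 - m ^ 2| := by
  rw [sq_sub_sq, abs_mul, abs_of_nonneg (by positivity : (0 : ℝ) ≤ n + m)]
  have key : ((n : ℝ) ^ 2 + m ^ 2) * ((min n m : ℕ) : ℝ) ≤ (n : ℝ) * m * ((n : ℝ) + m) := by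
    rcases le_total n m with h | h
    · rw [min_eq_left h]
      have h' : (n : ℝ) ≤ m := by exact_mod_cast h
      have hn : (0 : ℝ) ≤ n := by positivity
      nlinarith [mul_nonneg hn hn, mul_nonneg hn (sub_nonneg.mpr h')]
    · rw [min_eq_right h]
      have h' : (m : ℝ) ≤ n := by exact_mod_cast h
      have hm : (0 : ℝ) ≤ m := by positivity
      nlinarith [mul_nonneg hm hm, mul_nonneg hm (sub_nonneg.mpr h')]
  have := mul_le_mul_of_nonneg_right key (abs_nonneg ((n : ℝ) - m))
  linarith [this]

/-- `|(−1)^k| = 1` for an integer exponent. -/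
theorem abs_neg_one_zpow' (k : ℤ) : |(-1 : ℝ) ^ k| = 1 := by
  rcases Int.even_or_odd k with h | h
  · rw [h.neg_one_zpow, abs_one]
  · rw [h.neg_one_zpow, abs_neg, abs_one]

/-- `|n·r| ≤ C` from `|r| ≤ C/n`-type data: if `0 < n` and `|r| ≤ B/(π n)` then `|n r| ≤ B/π`. -/
theorem abs_nat_mul_le_of_abs_le_div {n : ℕ} (hn : (0 : ℝ) < n) {r B : ℝ} (h : |r| ≤ B / (π * n)) :
    |(n : ℝ) * r| ≤ B / π := by
  rw [abs_mul, abs_of_pos hn]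
  refine (mul_le_mul_of_nonneg_left h hn.le).trans (le_of_eq ?_)
  field_simp

/-- Difference of two numbers in `[0, C]` has absolute value `≤ 2C` (crude). -/
theorem abs_sub_le_two_mul_of_mem {x y C : ℝ} (hx0 : 0 ≤ x) (hx : x ≤ C) (hy0 : 0 ≤ y) (hy : y ≤ C) :
    |x - y| ≤ 2 * C := by
  rw [abs_le]; constructor <;> linarith

/-! ## The off-diagonal remainders -/

section Remainder

/-- **Even sector: off-diagonal = Hilbert main part + remainder.**  For `a > 0`, `n ≠ m`, `n, m ≥ 1`:
`|A⁺(n,m) − (−1)^{n+m}/(4(n+m))| ≤ (a(1+E)/π²)/(min(n,m)·|n−m|)`, `E = weilArchDensity (2a)`. -/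
theorem abs_evenArch_offDiag_sub_hilbert_le (ha : 0 < a) {n m : ℕ} (hn : 1 ≤ n) (hm : 1 ≤ m) (hnm : n ≠ m) :
    |(archCoeff a n m + archCoeff a n (-(m : ℤ))) / 2 - (-1 : ℝ) ^ ((n : ℤ) + m) / (4 * ((n : ℝ) + m))|
      ≤ (a * (1 + weilArchDensity (2 * a)) / π ^ 2) / (((min n m : ℕ) : ℝ) * |(n : ℝ) - m|) := by
  have hn0 : (0 : ℝ) < n := by exact_mod_cast hn
  have hm0 : (0 : ℝ) < m := by exact_mod_cast hm
  have hd1 : (n : ℝ) - m ≠ 0 := sub_ne_zero.mpr (by exact_mod_cast hnm)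
  have hd2 : (0 : ℝ) < (n : ℝ) + m := by positivity
  have hD : (n : ℝ) ^ 2 - m ^ 2 ≠ 0 := by rw [sq_sub_sq]; exact mul_ne_zero hd2.ne' hd1
  have hDpos : 0 < |(n : ℝ) ^ 2 - m ^ 2| := abs_pos.mpr hD
  -- the analytic inputs, then generalize the transcendental atoms to real variables
  have hrn := abs_nat_mul_le_of_abs_le_div hn0 (abs_im_digamma_freq_sub_le ha hn)
  have hrm := abs_nat_mul_le_of_abs_le_div hm0 (abs_im_digamma_freq_sub_le ha hm)
  have hTn0 := archExpSumSin_nonneg ha hn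
  have hTm0 := archExpSumSin_nonneg ha hm
  have htn : (n : ℝ) * archExpSumSin a n ≤ weilArchDensity (2 * a) * a / π := by
    refine (mul_le_mul_of_nonneg_left (archExpSumSin_le ha hn) hn0.le).trans (le_of_eq ?_)
    field_simp
  have htm : (m : ℝ) * archExpSumSin a m ≤ weilArchDensity (2 * a) * a / π := by
    refine (mul_le_mul_of_nonneg_left (archExpSumSin_le ha hm) hm0.le).trans (le_of_eq ?_)
    field_simp
  have hE0 : 0 < weilArchDensity (2 * a) := weilArchDensity_pos (by positivity)
  rw [evenArch_offDiag_eq a hn hm hnm]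
  generalize (Complex.digamma (1 / 4 + ((freq a n : ℝ) : ℂ) / 2 * I)).im = Yn at hrn ⊢
  generalize (Complex.digamma (1 / 4 + ((freq a m : ℝ) : ℂ) / 2 * I)).im = Ym at hrm ⊢
  generalize archExpSumSin a n = Tn at hTn0 htn ⊢
  generalize archExpSumSin a m = Tm at hTm0 htm ⊢
  generalize weilArchDensity (2 * a) = E at htn htm hE0 ⊢
  -- algebra: subtract the Hilbert main part
  have hrepr : (-1 : ℝ) ^ ((n : ℤ) + m) *
        (((n : ℝ) * Yn - m * Ym) / (2 * π * ((n : ℝ) ^ 2 - m ^ 2)) - ((n : ℝ) * Tn - m * Tm) / (π * ((n : ℝ) ^ 2 - m ^ 2)))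
        - (-1 : ℝ) ^ ((n : ℤ) + m) / (4 * ((n : ℝ) + m))
      = (-1 : ℝ) ^ ((n : ℤ) + m) *
        (((n : ℝ) * (Yn - π / 2) - m * (Ym - π / 2)) / (2 * π * ((n : ℝ) ^ 2 - m ^ 2))
          - ((n : ℝ) * Tn - m * Tm) / (π * ((n : ℝ) ^ 2 - m ^ 2))) := by
    field_simp
    ring
  rw [hrepr, abs_mul, abs_neg_one_zpow', one_mul]
  -- numerator bounds
  have hnum1 : |(n : ℝ) * (Yn - π / 2) - m * (Ym - π / 2)| ≤ 2 * a / π + 2 * a / π := by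
    rw [abs_le]
    have h1 := abs_le.mp hrn
    have h2 := abs_le.mp hrm
    constructor <;> linarith [h1.1, h1.2, h2.1, h2.2]
  have hnum2 : |(n : ℝ) * Tn - m * Tm| ≤ 2 * (E * a / π) :=
    abs_sub_le_two_mul_of_mem (mul_nonneg hn0.le hTn0) htn (mul_nonneg hm0.le hTm0) htm
  have h1 : |((n : ℝ) * (Yn - π / 2) - m * (Ym - π / 2)) / (2 * π * ((n : ℝ) ^ 2 - m ^ 2))|
      ≤ (2 * a / π + 2 * a / π) / (2 * π * |(n : ℝ) ^ 2 - m ^ 2|) := by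
    rw [abs_div, abs_mul, abs_of_pos (by positivity : (0 : ℝ) < 2 * π)]
    exact div_le_div_of_nonneg_right hnum1 (by positivity)
  have h2 : |((n : ℝ) * Tn - m * Tm) / (π * ((n : ℝ) ^ 2 - m ^ 2))|
      ≤ (2 * (E * a / π)) / (π * |(n : ℝ) ^ 2 - m ^ 2|) := by
    rw [abs_div, abs_mul, abs_of_pos Real.pi_pos]
    exact div_le_div_of_nonneg_right hnum2 (by positivity)
  refine ((abs_sub _ _).trans (add_le_add h1 h2)).trans ?_
  -- `2a(1+E)/(π²|n²−m²|) ≤ a(1+E)/(π² min |n−m|)`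
  have hmin := two_mul_min_mul_abs_sub_le n m
  have hminpos : 0 < ((min n m : ℕ) : ℝ) * |(n : ℝ) - m| := by
    have : (0 : ℝ) < ((min n m : ℕ) : ℝ) := by
      have : 1 ≤ min n m := le_min hn hm
      exact_mod_cast this
    exact mul_pos this (abs_pos.mpr hd1)
  have ha1 : 0 ≤ a * (1 + E) / π ^ 2 := by positivity
  have e : (2 * a / π + 2 * a / π) / (2 * π * |(n : ℝ) ^ 2 - m ^ 2|) + (2 * (E * a / π)) / (π * |(n : ℝ) ^ 2 - m ^ 2|)
      = (2 * (a * (1 + E) / π ^ 2)) / |(n : ℝ) ^ 2 - m ^ 2| := by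
    field_simp
    ring
  rw [e, div_le_div_iff₀ hDpos hminpos]
  calc 2 * (a * (1 + E) / π ^ 2) * (((min n m : ℕ) : ℝ) * |(n : ℝ) - m|)
      = (a * (1 + E) / π ^ 2) * (2 * ((min n m : ℕ) : ℝ) * |(n : ℝ) - m|) := by ring
    _ ≤ (a * (1 + E) / π ^ 2) * |(n : ℝ) ^ 2 - m ^ 2| := mul_le_mul_of_nonneg_left hmin ha1

/-- **Odd sector: off-diagonal = −Hilbert main part + remainder.**  For `a > 0`, `n ≠ m`, `n, m ≥ 1`:
`|A⁻(n,m) + (−1)^{n+m}/(4(n+m))| ≤ (a(1+E)/π²)/(min(n,m)·|n−m|)`. -/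
theorem abs_oddArch_offDiag_add_hilbert_le (ha : 0 < a) {n m : ℕ} (hn : 1 ≤ n) (hm : 1 ≤ m) (hnm : n ≠ m) :
    |(archCoeff a n m - archCoeff a n (-(m : ℤ))) / 2 + (-1 : ℝ) ^ ((n : ℤ) + m) / (4 * ((n : ℝ) + m))|
      ≤ (a * (1 + weilArchDensity (2 * a)) / π ^ 2) / (((min n m : ℕ) : ℝ) * |(n : ℝ) - m|) := by
  have hn0 : (0 : ℝ) < n := by exact_mod_cast hn
  have hm0 : (0 : ℝ) < m := by exact_mod_cast hm
  have hd1 : (n : ℝ) - m ≠ 0 := sub_ne_zero.mpr (by exact_mod_cast hnm)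
  have hd2 : (0 : ℝ) < (n : ℝ) + m := by positivity
  have hD : (n : ℝ) ^ 2 - m ^ 2 ≠ 0 := by rw [sq_sub_sq]; exact mul_ne_zero hd2.ne' hd1
  have hDpos : 0 < |(n : ℝ) ^ 2 - m ^ 2| := abs_pos.mpr hD
  have hrn := abs_im_digamma_freq_sub_le ha hn
  have hrm := abs_im_digamma_freq_sub_le ha hm
  have hTn0 := archExpSumSin_nonneg ha hn
  have hTm0 := archExpSumSin_nonneg ha hm
  have htn := archExpSumSin_le ha hn
  have htm := archExpSumSin_le ha hm
  have hE0 : 0 < weilArchDensity (2 * a) := weilArchDensity_pos (by positivity)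
  rw [oddArch_offDiag_eq a hn hm hnm]
  generalize (Complex.digamma (1 / 4 + ((freq a n : ℝ) : ℂ) / 2 * I)).im = Yn at hrn ⊢
  generalize (Complex.digamma (1 / 4 + ((freq a m : ℝ) : ℂ) / 2 * I)).im = Ym at hrm ⊢
  generalize archExpSumSin a n = Tn at hTn0 htn ⊢
  generalize archExpSumSin a m = Tm at hTm0 htm ⊢
  generalize weilArchDensity (2 * a) = E at htn htm hE0 ⊢
  have hrepr : (-1 : ℝ) ^ ((n : ℤ) + m) *
        (((m : ℝ) * Yn - n * Ym) / (2 * π * ((n : ℝ) ^ 2 - m ^ 2)) - ((m : ℝ) * Tn - n * Tm) / (π * ((n : ℝ) ^ 2 - m ^ 2)))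
        + (-1 : ℝ) ^ ((n : ℤ) + m) / (4 * ((n : ℝ) + m))
      = (-1 : ℝ) ^ ((n : ℤ) + m) *
        (((m : ℝ) * (Yn - π / 2) - n * (Ym - π / 2)) / (2 * π * ((n : ℝ) ^ 2 - m ^ 2))
          - ((m : ℝ) * Tn - n * Tm) / (π * ((n : ℝ) ^ 2 - m ^ 2))) := by
    field_simp
    ring
  rw [hrepr, abs_mul, abs_neg_one_zpow', one_mul]
  -- cross-weighted numerator bounds: `m|r_n| + n|r_m| ≤ (2a/π)(m/n + n/m)` etc.
  set W : ℝ := ((n : ℝ) ^ 2 + m ^ 2) / (n * m) with hW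
  have hW' : (m : ℝ) * (1 / n) + n * (1 / m) = W := by rw [hW]; field_simp; ring
  have hnum1 : |(m : ℝ) * (Yn - π / 2) - n * (Ym - π / 2)| ≤ 2 * a / π * W := by
    have h1 : |(m : ℝ) * (Yn - π / 2)| ≤ m * (2 * a / (π * n)) := by
      rw [abs_mul, abs_of_pos hm0]; exact mul_le_mul_of_nonneg_left hrn hm0.le
    have h2 : |(n : ℝ) * (Ym - π / 2)| ≤ n * (2 * a / (π * m)) := by
      rw [abs_mul, abs_of_pos hn0]; exact mul_le_mul_of_nonneg_left hrm hn0.le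
    refine (abs_sub _ _).trans ((add_le_add h1 h2).trans (le_of_eq ?_))
    rw [← hW']
    field_simp
  have hnum2 : |(m : ℝ) * Tn - n * Tm| ≤ E * a / π * W := by
    have h1 : (m : ℝ) * Tn ≤ m * (E * a / (π * n)) := mul_le_mul_of_nonneg_left htn hm0.le
    have h2 : (n : ℝ) * Tm ≤ n * (E * a / (π * m)) := mul_le_mul_of_nonneg_left htm hn0.le
    have e : (m : ℝ) * (E * a / (π * n)) + n * (E * a / (π * m)) = E * a / π * W := by
      rw [← hW']; field_simp
    have hp1 : 0 ≤ (m : ℝ) * Tn := mul_nonneg hm0.le hTn0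
    have hp2 : 0 ≤ (n : ℝ) * Tm := mul_nonneg hn0.le hTm0
    rw [abs_le]
    constructor <;> linarith
  have h1 : |((m : ℝ) * (Yn - π / 2) - n * (Ym - π / 2)) / (2 * π * ((n : ℝ) ^ 2 - m ^ 2))|
      ≤ (2 * a / π * W) / (2 * π * |(n : ℝ) ^ 2 - m ^ 2|) := by
    rw [abs_div, abs_mul, abs_of_pos (by positivity : (0 : ℝ) < 2 * π)]
    exact div_le_div_of_nonneg_right hnum1 (by positivity)
  have h2 : |((m : ℝ) * Tn - n * Tm) / (π * ((n : ℝ) ^ 2 - m ^ 2))|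
      ≤ (E * a / π * W) / (π * |(n : ℝ) ^ 2 - m ^ 2|) := by
    rw [abs_div, abs_mul, abs_of_pos Real.pi_pos]
    exact div_le_div_of_nonneg_right hnum2 (by positivity)
  refine ((abs_sub _ _).trans (add_le_add h1 h2)).trans ?_
  have hkey := sq_add_sq_mul_min_mul_abs_sub_le n m
  have hminpos : 0 < ((min n m : ℕ) : ℝ) * |(n : ℝ) - m| := by
    have : (0 : ℝ) < ((min n m : ℕ) : ℝ) := by
      have : 1 ≤ min n m := le_min hn hm
      exact_mod_cast this
    exact mul_pos this (abs_pos.mpr hd1)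
  have e : (2 * a / π * W) / (2 * π * |(n : ℝ) ^ 2 - m ^ 2|) + (E * a / π * W) / (π * |(n : ℝ) ^ 2 - m ^ 2|)
      = (a * (1 + E) / π ^ 2) * (((n : ℝ) ^ 2 + m ^ 2) / ((n : ℝ) * m * |(n : ℝ) ^ 2 - m ^ 2|)) := by
    rw [hW]
    field_simp
  rw [e, div_eq_mul_one_div (a * (1 + E) / π ^ 2)]
  refine mul_le_mul_of_nonneg_left ?_ (by positivity)
  rw [div_le_div_iff₀ (by positivity) hminpos, one_mul]
  calc ((n : ℝ) ^ 2 + m ^ 2) * (((min n m : ℕ) : ℝ) * |(n : ℝ) - m|)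
      = ((n : ℝ) ^ 2 + m ^ 2) * ((min n m : ℕ) : ℝ) * |(n : ℝ) - m| := by ring
    _ ≤ (n : ℝ) * m * |(n : ℝ) ^ 2 - m ^ 2| := hkey

end Remainder

/-! ## The diagonal lower bounds -/

section Diagonal

/-- **Even sector diagonal**: `A⁺(n,n) ≥ ½(Re ψ(¼+iω_n/2) − log π) − a(1+E)/(π²n²)` for `n ≥ 1`, `a > 0`. -/
theorem evenArch_diag_ge (ha : 0 < a) {n : ℕ} (hn : 1 ≤ n) :
    (reDigammaQuarter (freq a n) - Real.log π) / 2 - a * (1 + weilArchDensity (2 * a)) / (π ^ 2 * n ^ 2)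
      ≤ (archCoeff a n n + archCoeff a n (-(n : ℤ))) / 2 := by
  have hn0 : (0 : ℝ) < n := by exact_mod_cast hn
  have h4a : (0 : ℝ) < 4 * a := by positivity
  have hE0 : 0 < weilArchDensity (2 * a) := weilArchDensity_pos (by positivity)
  have h1 := abs_re_deriv_digamma_freq_div_le ha hn
  have h2 := abs_archExpSumDiag_le ha hn
  have h3 := abs_im_digamma_freq_sub_le ha hn
  have h4 := archExpSumSin_le ha hn
  rw [evenArch_diag_eq a hn]
  generalize (deriv Complex.digamma (1 / 4 + ((freq a n : ℝ) : ℂ) / 2 * I)).re = P at h1 ⊢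
  generalize archExpSumDiag a n = S at h2 ⊢
  generalize (Complex.digamma (1 / 4 + ((freq a n : ℝ) : ℂ) / 2 * I)).im = Y at h3 ⊢
  generalize archExpSumSin a n = T at h4 ⊢
  generalize weilArchDensity (2 * a) = E at h2 h4 hE0 ⊢
  -- real-variable consequences
  have hP : -(1 / (4 * n) + a / (π ^ 2 * n ^ 2)) ≤ P / (4 * a) := by
    have hP' : -|P| / (4 * a) ≤ P / (4 * a) := div_le_div_of_nonneg_right (neg_abs_le P) h4a.le
    rw [neg_div] at hP'
    linarith
  have hS : -(E * a / (π ^ 2 * n ^ 2)) ≤ -(S / a) := by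
    have hS1 : S ≤ E * a ^ 2 / (π ^ 2 * n ^ 2) := (le_abs_self S).trans h2
    have hS2 : S / a ≤ E * a ^ 2 / (π ^ 2 * n ^ 2) / a := div_le_div_of_nonneg_right hS1 ha.le
    have e : E * a ^ 2 / (π ^ 2 * n ^ 2) / a = E * a / (π ^ 2 * n ^ 2) := by
      field_simp
    linarith [e ▸ hS2]
  have hY : π / 2 - 2 * a / (π * n) ≤ Y := by
    have := neg_abs_le (Y - π / 2); linarith
  have h5 : (π / 2 - 2 * a / (π * n) - 2 * (E * a / (π * n))) / (4 * π * n) ≤ (Y - 2 * T) / (4 * π * n) :=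
    div_le_div_of_nonneg_right (by linarith) (by positivity)
  have e1 : (π / 2 - 2 * a / (π * n) - 2 * (E * a / (π * n))) / (4 * π * n)
      = 1 / (8 * n) - a * (1 + E) / (2 * π ^ 2 * n ^ 2) := by
    field_simp
    ring
  rw [e1] at h5
  have e2 : (reDigammaQuarter (freq a n) - Real.log π) / 2 - a * (1 + E) / (π ^ 2 * n ^ 2)
      = ((reDigammaQuarter (freq a n) - Real.log π) + (-(1 / (4 * n) + a / (π ^ 2 * n ^ 2)))
          + (-(E * a / (π ^ 2 * n ^ 2)))) / 2 + (1 / (8 * n) - a * (1 + E) / (2 * π ^ 2 * n ^ 2)) := by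
    field_simp
    ring
  rw [e2]
  linarith

/-- **Odd sector diagonal**: `A⁻(n,n) ≥ ½(Re ψ(¼+iω_n/2) − log π) − 1/(4n) − a(1+E)/(π²n²)` for `n ≥ 1`, `a > 0`. -/
theorem oddArch_diag_ge (ha : 0 < a) {n : ℕ} (hn : 1 ≤ n) :
    (reDigammaQuarter (freq a n) - Real.log π) / 2 - 1 / (4 * n)
        - a * (1 + weilArchDensity (2 * a)) / (π ^ 2 * n ^ 2)
      ≤ (archCoeff a n n - archCoeff a n (-(n : ℤ))) / 2 := by
  have hn0 : (0 : ℝ) < n := by exact_mod_cast hn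
  have h4a : (0 : ℝ) < 4 * a := by positivity
  have hE0 : 0 < weilArchDensity (2 * a) := weilArchDensity_pos (by positivity)
  have h1 := abs_re_deriv_digamma_freq_div_le ha hn
  have h2 := abs_archExpSumDiag_le ha hn
  have h3 := abs_im_digamma_freq_sub_le ha hn
  have h4 := archExpSumSin_nonneg ha hn
  rw [oddArch_diag_eq a hn]
  generalize (deriv Complex.digamma (1 / 4 + ((freq a n : ℝ) : ℂ) / 2 * I)).re = P at h1 ⊢
  generalize archExpSumDiag a n = S at h2 ⊢
  generalize (Complex.digamma (1 / 4 + ((freq a n : ℝ) : ℂ) / 2 * I)).im = Y at h3 ⊢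
  generalize archExpSumSin a n = T at h4 ⊢
  generalize weilArchDensity (2 * a) = E at h2 hE0 ⊢
  have hP : -(1 / (4 * n) + a / (π ^ 2 * n ^ 2)) ≤ P / (4 * a) := by
    have hP' : -|P| / (4 * a) ≤ P / (4 * a) := div_le_div_of_nonneg_right (neg_abs_le P) h4a.le
    rw [neg_div] at hP'
    linarith
  have hS : -(E * a / (π ^ 2 * n ^ 2)) ≤ -(S / a) := by
    have hS1 : S ≤ E * a ^ 2 / (π ^ 2 * n ^ 2) := (le_abs_self S).trans h2
    have hS2 : S / a ≤ E * a ^ 2 / (π ^ 2 * n ^ 2) / a := div_le_div_of_nonneg_right hS1 ha.le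
    have e : E * a ^ 2 / (π ^ 2 * n ^ 2) / a = E * a / (π ^ 2 * n ^ 2) := by
      field_simp
    linarith [e ▸ hS2]
  have hY : Y ≤ π / 2 + 2 * a / (π * n) := by
    have := le_abs_self (Y - π / 2); linarith
  have h5 : (Y - 2 * T) / (4 * π * n) ≤ (π / 2 + 2 * a / (π * n)) / (4 * π * n) :=
    div_le_div_of_nonneg_right (by linarith) (by positivity)
  have e1 : (π / 2 + 2 * a / (π * n)) / (4 * π * n) = 1 / (8 * n) + a / (2 * π ^ 2 * n ^ 2) := by
    field_simp
    ring
  rw [e1] at h5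
  have hsmall : a / (2 * π ^ 2 * n ^ 2) ≤ a * (1 + E) / (2 * π ^ 2 * n ^ 2) := by
    refine div_le_div_of_nonneg_right ?_ (by positivity)
    nlinarith
  have e2 : (reDigammaQuarter (freq a n) - Real.log π) / 2 - 1 / (4 * n) - a * (1 + E) / (π ^ 2 * n ^ 2)
      = ((reDigammaQuarter (freq a n) - Real.log π) + (-(1 / (4 * n) + a / (π ^ 2 * n ^ 2)))
          + (-(E * a / (π ^ 2 * n ^ 2)))) / 2 - (1 / (8 * n) + a * (1 + E) / (2 * π ^ 2 * n ^ 2)) := by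
    field_simp
    ring
  rw [e2]
  linarith

end Diagonal

end Summit.RiemannHypothesis.RiemannHypothesis.Theorems.WeilFormatC

end
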